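import Literature.IUT.LogVolume.Corollary22PartIII
import Literature.IUT.LogVolume.Corollary22PartI
import Literature.IUT.LogVolume.Corollary22HeightJ
import HarnessLib

/-!
# [IUTchIV] Corollary 2.2 (iii) — for EVERY compactly bounded subset `K_V`, no hypotheses on `K_V`

Mochizuki, *Inter-universal Teichmüller theory IV*, RIMS manuscript (Apr. 2020; = PRIMS **57** (2021)),
Cor. 2.2 (iii), p. 43.  Proof-only corollary file (abc-iut cell, FACT-LIST row F-1324 `Cor22.PartIII`; seat
abc-iut-f-135, gen 6) of the cell's `Corollary22PartIII.lean` (`exists_threshold_partIII_of_bdLe`: (iii) for every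
`K_V` on which `ht_{ω_X(D)} ≲ (1/6)·log(q^∀)`, for every `H_unif ≥ H₃`, `H₃ > 0` absolute) and of the two
HYPOTHESIS-FREE conjuncts of Cor. 2.2 (i): `Cor22.partI_middle` (`Corollary22PartI.lean`: `(1/6)·log(q^∀) ≈
(1/6)·ht_∞` on every `K_V` — the archimedean part of `h(j(λ))` is bounded on the compact `K_∞`) and
`Cor22.partI_third` (`Corollary22HeightJ.lean`: `(1/6)·ht_∞ ≈ ht_{ω_X(D)}`, `h(j(λ)) = 6h(λ) + O(1)`).  Hence the
bounded-discrepancy input holds on EVERY compactly bounded subset ([GenEll] Ex. 1.3 (ii), tree `GenEll.CBData`),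
WITHOUT the hypotheses `2 ∈ Supp(K_V)`, (∗^{j-inv}) of Cor. 2.2 (those enter only conjunct `(1/6)·log(q^{∤2}) ≈
(1/6)·log(q^∀)` of (i), which (iii) does not use):

* `bdLe_ht_logQForall` — `ht_{ω_X(D)} ≲ (1/6)·log(q^∀)` on every `K_V`;
* `exists_threshold_partIII_all` — **there is an absolute `H₃ > 0` with `Cor22.PartIII D H_unif` for EVERY
  compactly bounded `D` and EVERY `H_unif ≥ H₃`** (the universal closure of F-1324 over `D`; over `H_unif` the
  statement is thresholded, as print's "`H_unif` may be chosen in such a way that" says).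

Classical (Northcott + real analysis); uses neither Theorem 1.10 nor any Θ-data; nothing here takes a side on
[IUTchIII] Cor. 3.12 or asserts abc.  No definitions.
-/

noncomputable section

namespace Literature.IUT.LogVolume

namespace Cor22

open Literature.NumberTheory.DiophantineGeometry.GenEll

/-- **`ht_{ω_X(D)} ≲ (1/6)·log(q^∀)` on EVERY compactly bounded subset `K_V`** — from the two hypothesis-free
conjuncts of Cor. 2.2 (i) (`partI_middle`, `partI_third`: `(1/6)·log(q^∀) ≈ (1/6)·ht_∞ ≈ ht_{ω_X(D)}`).
[claim: Mochizuki2012, status: disputed] -/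
theorem bdLe_ht_logQForall (D : CBData) : BDLe D.toSet NFPoint.ht (fun P => 1 / 6 * logQForall P) :=
  ((partI_third D).symm.trans (partI_middle D).symm).bdLe

/-- **[IUTchIV] Cor. 2.2 (iii) for EVERY `K_V` and every `H_unif` above an absolute threshold**: there is
`H₃ > 0` ("`H_unif` … independent of `K_V`!", p. 43) such that `Cor22.PartIII D H_unif` holds for every
compactly bounded subset `D` (no hypothesis on its support, no (∗^{j-inv})) and every `H_unif ≥ H₃` — with
`H_K := 1`, `Exc_{ε,d} := {P ∈ K_V ∩ U_X(ℚ̄)^{≤d} | log(q^∀)(P) ≤ H_unif·ε^{−3}·ε_d^{−3}·d^{4+ε_d}}` (finite by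
Northcott), and `ε_E ≤ ε` off it. [claim: Mochizuki2012, status: disputed] -/
theorem exists_threshold_partIII_all :
    ∃ H₃ : ℝ, 0 < H₃ ∧ ∀ D : CBData, ∀ Hunif : ℝ, H₃ ≤ Hunif → PartIII D Hunif := by
  obtain ⟨H₃, hH₃, h⟩ := exists_threshold_partIII_of_bdLe
  exact ⟨H₃, hH₃, fun D Hunif hH => h D (bdLe_ht_logQForall D) Hunif hH⟩

/-- Pointwise form: for every `K_V` there are arbitrarily large admissible uniform constants — `PartIII D H_unif`
for all `H_unif ≥ H₃`; in particular `∃ H_unif > 0, PartIII D H_unif` for EVERY `D`.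
[claim: Mochizuki2012, status: disputed] -/
theorem exists_partIII (D : CBData) : ∃ Hunif : ℝ, 0 < Hunif ∧ PartIII D Hunif := by
  obtain ⟨H₃, hH₃, h⟩ := exists_threshold_partIII_all
  exact ⟨H₃, hH₃, h D H₃ le_rfl⟩

end Cor22

end Literature.IUT.LogVolume

end
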